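import Mathlib
import Summits.ValiantsHypothesis.ValiantsHypothesis.Theorems.BarrierLeverPartitionMinorsHitByVPSimplexJoinBoxGameDimensionLaw

/-!
# Route BarrierLever — item `PartitionMinorsHitByVP` (stmt-ValiantsHypothesis-19717), line `hidden_states`:
# THE TRANSFER PRINCIPLE AND THE DIMENSION LAW FOR THE WIDE CUT GAME (threshold / join designs)

Helper file (`--supports stmt-ValiantsHypothesis-19717`; cell valiant-natproofs, rung V4, 𝒟-side door (c), line
`Cruxes/PartitionMinorsHitByVP/Lines/hidden_states.lean` v8 (stubs `stub_universalJoinWide`, `stub_afitLower`, `stub_pairJoinWideLower`,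
`stub_simplexPairLower`); prover seat val-np-p3 gen 15). Definition-free. Closes NO item. Companion of p661257
(`…SimplexJoinBoxGameDimensionLaw`, the same two statements for SIMPLEX designs / the box game).

THE POINT. The u-oblivious CUT GAME of p647050 (`SymbJoin.symGood_of_winning`) is stated for WIDE column data
`e : Fin r → Fin m × Finset (Fin K)` (join / threshold designs, the language of the ball game of the val-np-p6 lineage and of the
registered stubs `stub_universalJoinWide`, `stub_afitLower`, `stub_pairJoinWideLower`): a predicate `W` that answers every demand in the
need range `[lam hd r, r/2]` by a cut is generically good for every lower row family. As for the box game, this reads backwards as a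
TRANSFER PRINCIPLE (`not_winning_of_singular`, for ANY certified demand floor `lam`): one injective lower family on `hd` coordinates against
which the block-additive matrix of `e` is singular for every table kills the position `e` for every such `W`. THE DIMENSION LAW
(`det_wideMatrix_eq_zero_of_stateCube`, `symDet_eq_zero_of_stateCube`, `not_winning_stateCube`): if `e` contains, inside ONE piece, an
injective binary `(t+1)`-cube of columns `i : (Fin (t+1) → Fin 2) → Fin r` such that the membership of every state in the column's state set
depends on at most ONE cube coordinate (e.g. the columns `J₀ ∪ I`, `I ⊆ R`, `|R| = t+1`, of a threshold piece containing `J₀ ∪ R`), then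
against any rows of size `≤ t` the alternating column vector `z ↦ (−1)^{|z|}` is in the kernel (the hidden point is affine in the cube
coordinates, so an entry is the value of a polynomial of total degree `≤ t` on `{0,1}^{t+1}`, killed by `altSum_eval_eq_zero` of p661257);
hence `¬ W hd r e` whenever `r ≤ B_t(hd)`. In words: a cut-game winning predicate (any floor) never holds at a position whose piece still
carries a free `(t+1)`-sub-cube of states while `r ≤ B_t(hd)` — the wide twin of `not_boxWinning_hypercube`.

WHAT THIS IS NOT: a necessary condition on cut-game winning predicates; no stub is touched; item 19717 OPEN; nothing on crux 14610 or VP ≠ VNP.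
-/

set_option linter.dupNamespace false

namespace Summit.ValiantsHypothesis.ValiantsHypothesis.Theorems.BarrierLever.HiddenStates

open Finset Matrix MvPolynomial

noncomputable section

namespace SymbJoin

/-! ## 1. A binary sub-cube of states in one piece is singular against rows of size `≤ t` -/

/-- **The singular configuration (wide designs, numeric form).** Let `e : Fin r → Fin m × Finset (Fin K)` contain an injective binary
`(t+1)`-cube `i` inside one piece such that the membership of every state `q` in `(e (i z)).2` depends only on `z (c q)`, and let every
row have size `≤ t`. Then for EVERY table the block-additive matrix is singular. -/
theorem det_wideMatrix_eq_zero_of_stateCube {m K h r t : ℕ}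
    (u : Fin r → Finset (Fin h)) (hut : ∀ row, (u row).card ≤ t)
    (e : Fin r → Fin m × Finset (Fin K)) (i : (Fin (t + 1) → Fin 2) → Fin r)
    (hinj : Function.Injective i)
    (hpiece : ∀ z, (e (i z)).1 = (e (i fun _ => 0)).1)
    (hcube : ∀ q : Fin K, ∃ c : Fin (t + 1), ∀ z z', z c = z' c → (q ∈ (e (i z)).2 ↔ q ∈ (e (i z')).2))
    (tx : Fin m → Option (Fin K) → Fin h → ℂ) :
    (Matrix.of fun row k : Fin r => ∏ a ∈ u row,
      (tx (e k).1 none a + ∑ q ∈ (e k).2, tx (e k).1 (some q) a)).det = 0 := by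
  classical
  set M : Matrix (Fin r) (Fin r) ℂ := Matrix.of fun row k : Fin r => ∏ a ∈ u row,
      (tx (e k).1 none a + ∑ q ∈ (e k).2, tx (e k).1 (some q) a) with hM
  set p : Fin m := (e (i fun _ => 0)).1 with hp
  choose c hc using hcube
  -- membership indicators as functions of one bit
  let ind : Fin K → Fin 2 → ℂ := fun q b => if q ∈ (e (i fun _ => b)).2 then 1 else 0
  have hind : ∀ z q, (if q ∈ (e (i z)).2 then (1 : ℂ) else 0) = ind q (z (c q)) := by
    intro z q
    have hzq : (q ∈ (e (i z)).2 ↔ q ∈ (e (i fun _ => z (c q))).2) := hc q z (fun _ => z (c q)) rfl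
    simp only [ind, hzq]
  -- the point coordinate as a sum over all states with indicators
  have hpt : ∀ z a, (tx p none a + ∑ q ∈ (e (i z)).2, tx p (some q) a)
      = tx p none a + ∑ q : Fin K, ind q (z (c q)) * tx p (some q) a := by
    intro z a
    congr 1
    rw [← Finset.sum_filter_add_sum_filter_not Finset.univ (fun q => q ∈ (e (i z)).2)]
    rw [Finset.filter_univ_mem]
    have hzero : ∑ q ∈ Finset.univ.filter (fun q => ¬ q ∈ (e (i z)).2), ind q (z (c q)) * tx p (some q) a = 0 := by
      refine Finset.sum_eq_zero fun q hq => ?_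
      rw [← hind z q, if_neg (Finset.mem_filter.mp hq).2, zero_mul]
    rw [hzero, add_zero]
    refine Finset.sum_congr rfl fun q hq => ?_
    rw [← hind z q, if_pos hq, one_mul]
  -- the affine polynomial of coordinate `a`
  let ℓ : Fin h → MvPolynomial (Fin (t + 1)) ℂ := fun a =>
    C (tx p none a + ∑ q : Fin K, ind q 0 * tx p (some q) a) +
      ∑ q : Fin K, C ((ind q 1 - ind q 0) * tx p (some q) a) * X (c q)
  have hℓdeg : ∀ a, (ℓ a).totalDegree ≤ 1 := by
    intro a
    refine (totalDegree_add _ _).trans (max_le (by rw [totalDegree_C]; exact Nat.zero_le _) ?_)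
    refine totalDegree_finsetSum_le fun q _ => ?_
    refine (totalDegree_mul _ _).trans ?_
    rw [totalDegree_C, totalDegree_X, zero_add]
  have hℓeval : ∀ (z : Fin (t + 1) → Fin 2) a,
      MvPolynomial.eval (fun c' => if z c' = 1 then (1 : ℂ) else 0) (ℓ a)
        = tx p none a + ∑ q : Fin K, ind q (z (c q)) * tx p (some q) a := by
    intro z a
    simp only [ℓ, map_add, map_sum, map_mul, eval_C, eval_X]
    rw [add_assoc, ← Finset.sum_add_distrib]
    congr 1
    refine Finset.sum_congr rfl fun q _ => ?_
    rcases Fin.exists_fin_two.mp ⟨z (c q), rfl⟩ with h0 | h1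
    · rw [h0]; simp
    · rw [h1]; simp only [if_true, mul_one]; ring
  -- the row polynomials
  let Q : Fin r → MvPolynomial (Fin (t + 1)) ℂ := fun row => ∏ a ∈ u row, ℓ a
  have hQdeg : ∀ row, (Q row).totalDegree < t + 1 := by
    intro row
    refine Nat.lt_succ_of_le ?_
    calc (Q row).totalDegree ≤ ∑ a ∈ u row, (ℓ a).totalDegree := totalDegree_finsetProd _ _
      _ ≤ ∑ a ∈ u row, 1 := Finset.sum_le_sum fun a _ => hℓdeg a
      _ = (u row).card := by simp
      _ ≤ t := hut row
  have hQeval : ∀ row (z : Fin (t + 1) → Fin 2),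
      MvPolynomial.eval (fun c' => if z c' = 1 then (1 : ℂ) else 0) (Q row) = M row (i z) := by
    intro row z
    rw [hM, Matrix.of_apply, map_prod]
    refine Finset.prod_congr rfl fun a _ => ?_
    rw [hℓeval, hpiece z, hpt z a]
  -- the kernel vector
  let sgn : (Fin (t + 1) → Fin 2) → ℂ := fun z => ∏ c', (if z c' = 1 then (-1 : ℂ) else 1)
  let v : Fin r → ℂ := fun k => ∑ z ∈ Finset.univ.filter (fun z => i z = k), sgn z
  have hv : v ≠ 0 := by
    intro hv0
    have h0 := congrFun hv0 (i fun _ => 0)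
    have hfil : (Finset.univ.filter fun z : Fin (t + 1) → Fin 2 => i z = i fun _ => 0) = {fun _ => 0} := by
      ext z
      simp only [Finset.mem_filter, Finset.mem_univ, true_and, Finset.mem_singleton]
      exact ⟨fun hz => hinj hz, fun hz => by rw [hz]⟩
    simp only [v, hfil, Finset.sum_singleton, sgn, Pi.zero_apply] at h0
    simp at h0
  apply Matrix.exists_mulVec_eq_zero_iff.mp
  refine ⟨v, hv, ?_⟩
  funext row
  rw [Pi.zero_apply, Matrix.mulVec, dotProduct]
  calc ∑ k, M row k * v k
      = ∑ k, ∑ z ∈ Finset.univ.filter (fun z => i z = k), M row (i z) * sgn z := by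
        refine Finset.sum_congr rfl fun k _ => ?_
        rw [Finset.mul_sum]
        exact Finset.sum_congr rfl fun z hz => by rw [(Finset.mem_filter.mp hz).2]
    _ = ∑ z, M row (i z) * sgn z := Finset.sum_fiberwise Finset.univ i (fun z => M row (i z) * sgn z)
    _ = ∑ z : Fin (t + 1) → Fin 2, sgn z *
          MvPolynomial.eval (fun c' => if z c' = 1 then (1 : ℂ) else 0) (Q row) := by
        refine Finset.sum_congr rfl fun z _ => ?_
        rw [hQeval, mul_comm]
    _ = 0 := SimplexJoin.Cut.altSum_eval_eq_zero (Q row) (hQdeg row)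

/-- The same law for the symbolic determinant of the cut game: `symDet u e = 0`. -/
theorem symDet_eq_zero_of_stateCube {m K h r t : ℕ}
    (u : Fin r → Finset (Fin h)) (hut : ∀ row, (u row).card ≤ t)
    (e : Fin r → Fin m × Finset (Fin K)) (i : (Fin (t + 1) → Fin 2) → Fin r)
    (hinj : Function.Injective i)
    (hpiece : ∀ z, (e (i z)).1 = (e (i fun _ => 0)).1)
    (hcube : ∀ q : Fin K, ∃ c : Fin (t + 1), ∀ z z', z c = z' c → (q ∈ (e (i z)).2 ↔ q ∈ (e (i z')).2)) :
    symDet u e = 0 := by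
  by_contra hne
  obtain ⟨tx, htx⟩ := exists_table_of_symGood u e hne
  exact htx (det_wideMatrix_eq_zero_of_stateCube u hut e i hinj hpiece hcube tx)

/-! ## 2. The transfer principle and the dimension law for cut-game winning predicates (any certified floor) -/

/-- **TRANSFER (cut game, any certified demand floor `lam`).** A predicate `W` satisfying the cut-game hypothesis of
`symGood_of_winning` holds at NO position `e` at `(hd, r)` against which the block-additive matrix is singular, for every table, for SOME
injective lower row family on `hd` coordinates. -/
theorem not_winning_of_singular {m K : ℕ}
    (W : (hd : ℕ) → (r : ℕ) → (Fin r → Fin m × Finset (Fin K)) → Prop) (lam : ℕ → ℕ → ℕ)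
    (hlam : ∀ (hd r : ℕ) {h : ℕ} (u : Fin r → Finset (Fin h)) (C : Finset (Fin h)), C.card ≤ hd → Function.Injective u →
      IsLowerSet (Set.range u) → (∀ i, u i ⊆ C) → 2 ≤ r → ∃ x ∈ C, lam hd r ≤ (Finset.univ.filter fun i => x ∈ u i).card)
    (hwin : ∀ (hd r : ℕ) (e : Fin r → Fin m × Finset (Fin K)), W hd r e → 2 ≤ r → 1 ≤ hd →
      ∀ r₀ r₁ : ℕ, r₀ + r₁ = r → lam hd r ≤ r₁ → r₁ ≤ r₀ → r₀ ≤ 2 ^ (hd - 1) →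
        ∃ (β : Fin m → ℂ) (γ : Fin m → Fin K → ℂ) (g₀ : Fin r₀ → Fin r) (g₁ : Fin r₁ → Fin r),
          Function.Injective (Sum.elim g₀ g₁) ∧ (∀ j, xi e β γ (g₀ j) = 0) ∧ (∀ j, xi e β γ (g₁ j) ≠ 0) ∧
          W (hd - 1) r₀ (fun j => e (g₀ j)) ∧ W (hd - 1) r₁ (fun j => e (g₁ j)))
    (hd r : ℕ) (e : Fin r → Fin m × Finset (Fin K))
    (u : Fin r → Finset (Fin hd)) (hu : Function.Injective u) (hlow : IsLowerSet (Set.range u))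
    (hsing : ∀ tx : Fin m → Option (Fin K) → Fin hd → ℂ,
      (Matrix.of fun row k : Fin r => ∏ a ∈ u row, (tx (e k).1 none a + ∑ q ∈ (e k).2, tx (e k).1 (some q) a)).det = 0) :
    ¬ W hd r e := by
  intro hW
  have hgood : symDet u e ≠ 0 :=
    symGood_of_winning W lam (fun hd r u C hCd hu hl hC hr => hlam hd r u C hCd hu hl hC hr) hwin hd r u Finset.univ e
      (by rw [Finset.card_univ, Fintype.card_fin]) hu hlow (fun i => Finset.subset_univ _) hW
  obtain ⟨tx, htx⟩ := exists_table_of_symGood u e hgood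
  exact htx (hsing tx)

/-- **THE DIMENSION LAW FOR THE CUT GAME (any certified floor).** For every `W` with the cut-game hypothesis: if `r ≤ B_t(hd)` and `e`
contains, inside one piece, an injective binary `(t+1)`-cube of columns on which every state's membership reads at most one cube
coordinate, then `¬ W hd r e`. (Instances of `lam`/`hlam`: the crude floor `exists_link_ge`, the layer-cake floor
`exists_link_ge_layerCake`.) -/
theorem not_winning_stateCube {m K : ℕ}
    (W : (hd : ℕ) → (r : ℕ) → (Fin r → Fin m × Finset (Fin K)) → Prop) (lam : ℕ → ℕ → ℕ)
    (hlam : ∀ (hd r : ℕ) {h : ℕ} (u : Fin r → Finset (Fin h)) (C : Finset (Fin h)), C.card ≤ hd → Function.Injective u →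
      IsLowerSet (Set.range u) → (∀ i, u i ⊆ C) → 2 ≤ r → ∃ x ∈ C, lam hd r ≤ (Finset.univ.filter fun i => x ∈ u i).card)
    (hwin : ∀ (hd r : ℕ) (e : Fin r → Fin m × Finset (Fin K)), W hd r e → 2 ≤ r → 1 ≤ hd →
      ∀ r₀ r₁ : ℕ, r₀ + r₁ = r → lam hd r ≤ r₁ → r₁ ≤ r₀ → r₀ ≤ 2 ^ (hd - 1) →
        ∃ (β : Fin m → ℂ) (γ : Fin m → Fin K → ℂ) (g₀ : Fin r₀ → Fin r) (g₁ : Fin r₁ → Fin r),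
          Function.Injective (Sum.elim g₀ g₁) ∧ (∀ j, xi e β γ (g₀ j) = 0) ∧ (∀ j, xi e β γ (g₁ j) ≠ 0) ∧
          W (hd - 1) r₀ (fun j => e (g₀ j)) ∧ W (hd - 1) r₁ (fun j => e (g₁ j)))
    (t : ℕ) :
    ∀ (r hd : ℕ) (e : Fin r → Fin m × Finset (Fin K)) (i : (Fin (t + 1) → Fin 2) → Fin r),
      r ≤ ∑ j ∈ Finset.range (t + 1), hd.choose j → Function.Injective i →
      (∀ z, (e (i z)).1 = (e (i fun _ => 0)).1) →
      (∀ q : Fin K, ∃ c : Fin (t + 1), ∀ z z', z c = z' c → (q ∈ (e (i z)).2 ↔ q ∈ (e (i z')).2)) →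
      ¬ W hd r e := by
  intro r hd e i hr hinj hpiece hcube
  obtain ⟨u, hu, hlow, hut⟩ := SimplexJoin.Cut.exists_lower_family_card_le hd t r hr
  exact not_winning_of_singular W lam hlam hwin hd r e u hu hlow
    (fun tx => det_wideMatrix_eq_zero_of_stateCube u hut e i hinj hpiece hcube tx)

/-- **Crude floor instance** (`lam hd r = ⌊(r−2)/hd⌋ + 1`, certified by `exists_link_ge`, p647050). -/
theorem not_winning_stateCube_crude {m K : ℕ}
    (W : (hd : ℕ) → (r : ℕ) → (Fin r → Fin m × Finset (Fin K)) → Prop)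
    (hwin : ∀ (hd r : ℕ) (e : Fin r → Fin m × Finset (Fin K)), W hd r e → 2 ≤ r → 1 ≤ hd →
      ∀ r₀ r₁ : ℕ, r₀ + r₁ = r → (r - 2) / hd + 1 ≤ r₁ → r₁ ≤ r₀ → r₀ ≤ 2 ^ (hd - 1) →
        ∃ (β : Fin m → ℂ) (γ : Fin m → Fin K → ℂ) (g₀ : Fin r₀ → Fin r) (g₁ : Fin r₁ → Fin r),
          Function.Injective (Sum.elim g₀ g₁) ∧ (∀ j, xi e β γ (g₀ j) = 0) ∧ (∀ j, xi e β γ (g₁ j) ≠ 0) ∧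
          W (hd - 1) r₀ (fun j => e (g₀ j)) ∧ W (hd - 1) r₁ (fun j => e (g₁ j)))
    (t : ℕ) :
    ∀ (r hd : ℕ) (e : Fin r → Fin m × Finset (Fin K)) (i : (Fin (t + 1) → Fin 2) → Fin r),
      r ≤ ∑ j ∈ Finset.range (t + 1), hd.choose j → Function.Injective i →
      (∀ z, (e (i z)).1 = (e (i fun _ => 0)).1) →
      (∀ q : Fin K, ∃ c : Fin (t + 1), ∀ z z', z c = z' c → (q ∈ (e (i z)).2 ↔ q ∈ (e (i z')).2)) →
      ¬ W hd r e :=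
  not_winning_stateCube W (fun hd r => (r - 2) / hd + 1)
    (fun hd _ _ u C hCd hu _ hC hr => exists_link_ge hd u C hCd hu hC hr) hwin t

end SymbJoin

end

end Summit.ValiantsHypothesis.ValiantsHypothesis.Theorems.BarrierLever.HiddenStates
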